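import Summits.CriticalPhenomena.CardyFormulaZ2.Theses.CardyQContinuation
import Summits.CriticalPhenomena.CardyFormulaZ2.Theorems.CardyQContinuationIsingJetsConformalStubMeshBoundaryUnionArcs
import Literature.Probability.Percolation.BoxCrossingProofs
import Literature.Probability.LatticeModels.MeshDomainJordan

/-!
# Crux `IsingJetsConformal`, stub `stub_loopSymmetricLimit_arcLocalisation`:
# localisation of discrete boundary vertices on the discrete arcs, and deep lattice edges are
# edges of `Ω_δ` (route `CardyQContinuation`, item stmt-CriticalPhenomena-5560)

The `n = 0` bridge of the crux sandwiches the FK crossing probability of the tree's discretisation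
`Ω_δ = discreteDomainGraph R.carrier δ` of a conformal rectangle `R` (vertex set `meshDomain`,
vertex boundary `meshBoundary`, discrete arcs `discreteArc R.carrier δ (R.arc i)`,
`Literature/Probability/LatticeModels/DomainDiscretisation.lean`) between Chelkak–Smirnov discrete
quadrilaterals glued onto `Ω_δ`. Edges glued to `Ω_δ` touch it only at discrete boundary vertices;
this file proves the three elementary localisation facts the gluing uses:

1. a discrete boundary vertex whose mesh point is `δ`-far (strictly farther than the mesh `δ > 0`)
   from the two arcs `R.arc 1 ∪ R.arc 3` lies in the discrete arcs of `R.arc 0` or `R.arc 2`;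
2. symmetrically with the roles of `{0, 2}` and `{1, 3}` exchanged;
3. for every `ε > 0` and all small mesh `δ` (`∀ᶠ δ in 𝓝[>] 0`), a lattice edge `xy` of `ℤ²` whose
   endpoint `δx` lies in the domain at distance `≥ ε` from `∂Ω` is an edge of `Ω_δ`.

Proofs. (1–2) The discrete boundary is the union of the four discrete arcs
(`stub_isingCrossingConformal_meshBoundary_eq_iUnion_discreteArc`), and a vertex of the discrete
arc of `A` is within `|δ|` of `A` (`infDist_le_of_mem_discreteArc`), while
`infDist z (A ∪ B) ≤ infDist z A`; so the vertex cannot sit on the discrete arc of a far arc.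
(3) Take the compact `K = Ω̄ ∩ {z | ε/2 ≤ infDist z ∂Ω} ⊆ Ω`; for small `δ` all lattice points of
`K` lie in `meshDomain` (`JordanDomain.eventually_forall_mem_meshDomain'`, the largest mesh
component of a Jordan domain swallows every compact). If moreover `δ < ε/2`, the closed mesh edge
`[δx, δy]` (of length `δ`) stays at distance `> ε/2` from `∂Ω`, hence inside `Ω` (a segment leaving
an open set meets its frontier, `exists_mem_segment_frontier`), so both endpoints are lattice
points of `K` and the edge is a mesh-graph edge; `discreteDomainGraph_adj_iff` concludes.

References: S. Smirnov, C. R. Acad. Sci. Paris 333 (2001), §2 (the discretisation);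
D. Chelkak, S. Smirnov, Invent. Math. 189 (2012), §1.2.
-/

namespace Summit.CriticalPhenomena.CardyFormulaZ2.Theorems.CardyQContinuation

open Set Metric Filter Topology
open Literature.Probability.LatticeModels
open Literature.Probability.RandomPlanarGeometry
open Literature.Probability.Percolation

noncomputable section

namespace ArcLocalisation

/-- **Far arcs have no nearby discrete-arc vertices.** For a positive mesh `δ`, a vertex whose
mesh point is at distance `> δ` from a set `S ⊇ R.arc i` is not on the discrete arc of `R.arc i`
(discrete-arc vertices are within `|δ|` of their arc, `infDist_le_of_mem_discreteArc`).
(Smirnov 2001, §2.) [folklore] -/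
theorem not_mem_discreteArc_of_lt_infDist (R : ConformalRectangle) {δ : ℝ} (hδ : 0 < δ)
    {x : Site 2} {i : Fin 4} {S : Set ℂ} (hS : R.arc i ⊆ S)
    (h : δ < infDist (meshPoint δ x) S) : x ∉ discreteArc R.carrier δ (R.arc i) := fun hx => by
  have h1 := infDist_le_of_mem_discreteArc R.isOpen hx
  have h2 : infDist (meshPoint δ x) S ≤ infDist (meshPoint δ x) (R.arc i) :=
    infDist_le_infDist_of_subset hS ⟨_, R.pt_mem_arc_self i⟩
  rw [abs_of_pos hδ] at h1
  linarith

/-- **Conjunct 1.** A discrete boundary vertex `δ`-far from `R.arc 1 ∪ R.arc 3` lies on the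
discrete arc of `R.arc 0` or of `R.arc 2` (the four discrete arcs cover the discrete boundary).
(Smirnov 2001, §2.) [folklore] -/
theorem mem_discreteArc_zero_union_two (R : ConformalRectangle) {δ : ℝ} (hδ : 0 < δ) {x : Site 2}
    (hx : x ∈ meshBoundary R.carrier δ)
    (h : δ < infDist (meshPoint δ x) (R.arc 1 ∪ R.arc 3)) :
    x ∈ discreteArc R.carrier δ (R.arc 0) ∪ discreteArc R.carrier δ (R.arc 2) := by
  rw [stub_isingCrossingConformal_meshBoundary_eq_iUnion_discreteArc R δ, mem_iUnion] at hx
  obtain ⟨i, hi⟩ := hx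
  fin_cases i
  · exact Or.inl hi
  · exact absurd hi (not_mem_discreteArc_of_lt_infDist R hδ subset_union_left h)
  · exact Or.inr hi
  · exact absurd hi (not_mem_discreteArc_of_lt_infDist R hδ subset_union_right h)

/-- **Conjunct 2.** A discrete boundary vertex `δ`-far from `R.arc 0 ∪ R.arc 2` lies on the
discrete arc of `R.arc 1` or of `R.arc 3`. (Smirnov 2001, §2.) [folklore] -/
theorem mem_discreteArc_one_union_three (R : ConformalRectangle) {δ : ℝ} (hδ : 0 < δ) {x : Site 2}
    (hx : x ∈ meshBoundary R.carrier δ)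
    (h : δ < infDist (meshPoint δ x) (R.arc 0 ∪ R.arc 2)) :
    x ∈ discreteArc R.carrier δ (R.arc 1) ∪ discreteArc R.carrier δ (R.arc 3) := by
  rw [stub_isingCrossingConformal_meshBoundary_eq_iUnion_discreteArc R δ, mem_iUnion] at hx
  obtain ⟨i, hi⟩ := hx
  fin_cases i
  · exact absurd hi (not_mem_discreteArc_of_lt_infDist R hδ subset_union_left h)
  · exact Or.inl hi
  · exact absurd hi (not_mem_discreteArc_of_lt_infDist R hδ subset_union_right h)
  · exact Or.inr hi

/-- **The deep compact.** For a Jordan domain `D` and `ε > 0`, the set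
`K = closure D ∩ {z | ε ≤ infDist z ∂D}` is compact and contained in `D` (a point of the closure
at positive distance from the frontier is an interior point). [folklore] -/
theorem isCompact_closure_inter_setOf_le_infDist_frontier (D : JordanDomain) {ε : ℝ} (hε : 0 < ε) :
    IsCompact (closure D.carrier ∩ {z : ℂ | ε ≤ infDist z (frontier D.carrier)}) ∧
      closure D.carrier ∩ {z : ℂ | ε ≤ infDist z (frontier D.carrier)} ⊆ D.carrier := by
  refine ⟨Metric.isCompact_of_isClosed_isBounded
    (isClosed_closure.inter (isClosed_le continuous_const (continuous_infDist_pt _)))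
    (D.isBounded.closure.subset inter_subset_left), ?_⟩
  rintro z ⟨hzc, hz⟩
  by_contra hzΩ
  have hzf : z ∈ frontier D.carrier := ⟨hzc, by rwa [D.isOpen.interior_eq]⟩
  have h0 := infDist_zero_of_mem hzf
  simp only [mem_setOf_eq] at hz
  linarith

/-- **A short mesh edge from a deep point stays in the domain.** If `δx ∈ Ω` (open) is at
distance `≥ ε` from `∂Ω`, `xy` is a lattice edge and `|δ| < ε`, then the closed mesh edge
`[δx, δy]` lies in `Ω` (otherwise it meets `∂Ω` within `|δ|` of `δx`). [folklore] -/
theorem segment_subset_of_le_infDist_frontier {Ω : Set ℂ} (hΩ : IsOpen Ω) {δ ε : ℝ}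
    (hδε : |δ| < ε) {x y : Site 2} (hxΩ : meshPoint δ x ∈ Ω)
    (hxε : ε ≤ infDist (meshPoint δ x) (frontier Ω)) (hxy : (zdGraph 2).Adj x y) :
    segment ℝ (meshPoint δ x) (meshPoint δ y) ⊆ Ω := by
  by_contra hcon
  obtain ⟨w, hw, hwf⟩ := exists_mem_segment_frontier hΩ hxΩ hcon
  have h1 : infDist (meshPoint δ x) (frontier Ω) ≤ dist (meshPoint δ x) w :=
    infDist_le_dist_of_mem hwf
  have h2 : dist (meshPoint δ x) w ≤ |δ| := by
    have hsub : segment ℝ (meshPoint δ x) (meshPoint δ y) ⊆ closedBall (meshPoint δ x) |δ| :=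
      (convex_closedBall _ _).segment_subset (mem_closedBall_self (abs_nonneg δ))
        (by rw [mem_closedBall, dist_comm, dist_meshPoint_of_adj hxy])
    have := hsub hw
    rwa [mem_closedBall, dist_comm] at this
  linarith

/-- **Conjunct 3.** For `ε > 0` and all small mesh `δ > 0`, a lattice edge `xy` whose endpoint
`δx ∈ Ω` is at distance `≥ ε` from `∂Ω` is an edge of `Ω_δ = discreteDomainGraph Ω δ`: both
endpoints are lattice points of the deep compact `Ω̄ ∩ {ε/2 ≤ infDist · ∂Ω}`, swallowed by
`meshDomain` for small mesh (`JordanDomain.eventually_forall_mem_meshDomain'`), and the closed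
edge lies in `Ω ⊆ Ω̄`. (Smirnov 2001, §2.) [folklore] -/
theorem eventually_adj_discreteDomainGraph (R : ConformalRectangle) {ε : ℝ} (hε : 0 < ε) :
    ∀ᶠ δ in nhdsWithin (0 : ℝ) (Set.Ioi 0), ∀ x y : Site 2, meshPoint δ x ∈ R.carrier →
      ε ≤ infDist (meshPoint δ x) (frontier R.carrier) → (zdGraph 2).Adj x y →
      (discreteDomainGraph R.carrier δ).Adj x y := by
  obtain ⟨hKc, hKΩ⟩ :=
    isCompact_closure_inter_setOf_le_infDist_frontier R.toJordanDomain (half_pos hε)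
  filter_upwards [R.toJordanDomain.eventually_forall_mem_meshDomain' hKc hKΩ,
    Ioo_mem_nhdsGT (half_pos hε)] with δ hdom hδ
  intro x y hxΩ hxε hxy
  have hδabs : |δ| < ε := by rw [abs_of_pos hδ.1]; linarith [hδ.2]
  have hseg := segment_subset_of_le_infDist_frontier R.isOpen hδabs hxΩ hxε hxy
  have hyΩ : meshPoint δ y ∈ R.carrier := hseg (right_mem_segment ℝ _ _)
  have hyε : ε / 2 ≤ infDist (meshPoint δ y) (frontier R.carrier) := by
    have h1 := infDist_le_infDist_add_dist (s := frontier R.carrier) (x := meshPoint δ x)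
      (y := meshPoint δ y)
    rw [dist_meshPoint_of_adj hxy, abs_of_pos hδ.1] at h1
    linarith [hδ.2]
  have hxK : meshPoint δ x ∈ closure R.carrier ∩ {z : ℂ | ε / 2 ≤ infDist z (frontier R.carrier)} :=
    ⟨subset_closure hxΩ, by simp only [mem_setOf_eq]; linarith⟩
  have hyK : meshPoint δ y ∈ closure R.carrier ∩ {z : ℂ | ε / 2 ≤ infDist z (frontier R.carrier)} :=
    ⟨subset_closure hyΩ, hyε⟩
  exact discreteDomainGraph_adj_iff.2
    ⟨meshGraph_adj_iff.2 ⟨hxy, hseg.trans subset_closure⟩, hdom.1 x hxK, hdom.1 y hyK⟩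

end ArcLocalisation

open ArcLocalisation

/-- **Stub `stub_loopSymmetricLimit_arcLocalisation`** of the skeleton of the crux
`IsingJetsConformal` (stmt-CriticalPhenomena-5560), the three localisation facts of the `n = 0`
bridge: (1) a discrete boundary vertex `δ`-far from the arcs `1, 3` is on the discrete arcs
`0` or `2`; (2) symmetrically; (3) for small mesh, lattice edges from `ε`-deep points of the
domain are edges of `Ω_δ`. (Smirnov 2001, §2.) [folklore] -/
theorem stub_loopSymmetricLimit_arcLocalisation : ((∀ (R : Literature.Probability.RandomPlanarGeometry.ConformalRectangle) (δ : ℝ), 0 < δ → ∀ x ∈ Literature.Probability.LatticeModels.meshBoundary R.carrier δ, δ < Metric.infDist (Literature.Probability.LatticeModels.meshPoint δ x) (R.arc 1 ∪ R.arc 3) → x ∈ Literature.Probability.LatticeModels.discreteArc R.carrier δ (R.arc 0) ∪ Literature.Probability.LatticeModels.discreteArc R.carrier δ (R.arc 2)) ∧ (∀ (R : Literature.Probability.RandomPlanarGeometry.ConformalRectangle) (δ : ℝ), 0 < δ → ∀ x ∈ Literature.Probability.LatticeModels.meshBoundary R.carrier δ, δ < Metric.infDist (Literature.Probability.LatticeModels.meshPoint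 δ x) (R.arc 0 ∪ R.arc 2) → x ∈ Literature.Probability.LatticeModels.discreteArc R.carrier δ (R.arc 1) ∪ Literature.Probability.LatticeModels.discreteArc R.carrier δ (R.arc 3)) ∧ (∀ (R : Literature.Probability.RandomPlanarGeometry.ConformalRectangle) (ε : ℝ), 0 < ε → ∀ᶠ δ in nhdsWithin (0 : ℝ) (Set.Ioi 0), ∀ x y : Literature.Probability.LatticeModels.Site 2, Literature.Probability.LatticeModels.meshPoint δ x ∈ R.carrier → ε ≤ Metric.infDist (Literature.Probability.LatticeModels.meshPoint δ x) (frontier R.carrier) → (Literature.Probability.LatticeModels.zdGraph 2).Adj x y → (Literature.Probability.LatticeModels.discreteDomainGraph R.carrier δ).Adj x y)) := by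
  refine ⟨fun R δ hδ x hx h => mem_discreteArc_zero_union_two R hδ hx h,
    fun R δ hδ x hx h => mem_discreteArc_one_union_three R hδ hx h,
    fun R ε hε => eventually_adj_discreteDomainGraph R hε⟩

end

end Summit.CriticalPhenomena.CardyFormulaZ2.Theorems.CardyQContinuation
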